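import Summits.QuantumFields.BalabanUV.T4Continuum.Support.RegularBackgroundTower

/-!
# T⁴ programme, spine node NE2 (U1a) — row B5, interface forms: the PER-BOND reading of `RegularTransporters` (the shape rows B3.a /
# B3.b consume) and the NE3 edge for a LARGER class of coefficient towers (the shape the assembly B7 consumes)

NE2 formalisation swarm, leaf prover 03, companion of `Support/RegularBackgroundTower` (row B5 of `t4/formal/NE2/LEAVES.md`); written after
the cross-read of row B3.a (`Support/CovariantBlockAveraging[Tower]`, whose size hypothesis is `‖R^{(k)}_ν(x) − 1‖ ≤ α/L^k`) so that no
consumer re-derives the conversions inline.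

 * §1 PER-BOND FORMS: `RegularTransporters.size` (`‖L^k·(R − 1)‖ ≤ α`) ⟺ `‖R − 1‖ ≤ α/L^k` (**`norm_transporter_sub_one_le`**), and
   `RegularTransporters.lipschitz` (`‖L^k·(R(x + e_μ) − R(x))‖ ≤ β/L^k`) ⟺ `‖R(x + e_μ) − R(x)‖ ≤ β/(L^k)²`
   (**`norm_transporter_tau_sub_le`**); the converse constructor **`regularTransporters_of_perBond`** (either form is an entry point).
 * §2 THE NE3 EDGE ON A LARGER CLASS: `LocalRate` of `NE2FromNE3.bgReadings` is ANTITONE in the class (**`localRate_bgReadings_mono`** —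
   `LocalRate` quantifies over the members), hence the matrix-level hypotheses of `Support/ColourCovariantLaplacian` and the covariant-Laplacian
   summand's `PerturbationLaws` from `(hreg : RegularTransporters R α β)`, `(h𝒟 : regClass R ⊆ 𝒟)` and ONE NE3 hypothesis
   `(hNE3 : LocalRate (bgReadings 𝒟) C L⁻¹)` on whatever class `𝒟` the assembly B7 feeds to node NE3 for ALL summands at once
   (**`matrixBounds_of_regular_of_localRate_sup`**, **`perturbationLaws_covariantLaplacian_of_regular_sup`**) — binders displayed.

HONEST FRAMING (T4-DAG p. 1).  Pure bookkeeping (norm of a scalar multiple; monotonicity of a `∀`); model level; nothing asserted about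
Bałaban's minimisers; `hNE3` is node NE3's own tree predicate consumed BY NAME (OPEN); NE2 NOT proved; NOT infinite volume, NOT a mass gap,
NOT Clay, NOT summit progress; spine 0/9 unchanged.  HONEST DEPENDENCY: continuum YM on T⁴ ⇐ BetaPertH ∧ nine spine estimates (0/9
proved); BetaPertH ⇐ (D1) ∧ (D4) ∧ CAP+tail; G-an2-4 gates asym, D1 and NE2/3/4.  ABSOLUTE RULE kept; no `sorry`.
-/

noncomputable section

open scoped BigOperators Matrix Matrix.Norms.L2Operator Kronecker

namespace Summit.QuantumFields.BalabanUV.T4Continuum.RegularTransportersPerBond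

open Literature.MathematicalPhysics.QuantumFieldTheory.Balaban1983to89.B5Prop11Plancherel
open Literature.MathematicalPhysics.QuantumFieldTheory.Balaban1983to89.B5G183RateUnitTower (lev lev_neZero)
open Literature.MathematicalPhysics.QuantumFieldTheory.Balaban1983to89.T4EtaRateMin (Readings LocalRate)
open Summit.QuantumFields.BalabanUV.T4Continuum
open Summit.QuantumFields.BalabanUV.T4Continuum.BalabanAveragedTowerUnit (idx one_le_lev' cast_lev')
open Summit.QuantumFields.BalabanUV.T4Continuum.BackgroundResolventTower
open Summit.QuantumFields.BalabanUV.T4Continuum.KingPairingPlantedLaw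
open Summit.QuantumFields.BalabanUV.T4Continuum.BlockPairingGeometry (tau parT)
open Summit.QuantumFields.BalabanUV.T4Continuum.ColourCovariantLaplacian
open Summit.QuantumFields.BalabanUV.T4Continuum.NE2FromNE3 (bgReadings consistent_of_localRate_lev)
open Summit.QuantumFields.BalabanUV.T4Continuum.RegularBackgroundTower

variable {d : ℕ} {o : Type*} [Fintype o] [DecidableEq o]

/-! ## §1 Per-bond forms -/

section PerBond
variable {L : ℕ} [NeZero L] {M : Fin d → ℕ} {R : (k : ℕ) → Fin d → (idx L M k → Matrix o o ℂ)} {α β : ℝ}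

/-- **SIZE, per bond**: `‖R^{(k)}_ν(x) − 1‖ ≤ α/L^k` (the hypothesis shape of `CovariantBlockAveraging.opNorm_Ecov_le`). [folklore] -/
theorem norm_transporter_sub_one_le (h : RegularTransporters L M R α β) (k : ℕ) (ν : Fin d) (i : idx L M k) :
    ‖R k ν i - 1‖ ≤ α / (lev L k : ℕ) := by
  have h1 := h.size k ν i
  rw [norm_smul, Complex.norm_natCast] at h1
  rw [le_div_iff₀ (lev_pos L k), mul_comm]; exact h1

/-- **LIPSCHITZ, per bond**: `‖R^{(k)}_ν(x + e_μ) − R^{(k)}_ν(x)‖ ≤ β/(L^k)²`. [folklore] -/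
theorem norm_transporter_tau_sub_le (h : RegularTransporters L M R α β) (k : ℕ) (ν μ : Fin d) (i : idx L M k) :
    ‖R k ν (tau (fine (lev L k) M) μ i) - R k ν i‖ ≤ β / (lev L k : ℕ) ^ 2 := by
  have hlev := lev_pos L k
  have h1 := h.lipschitz k ν μ i
  rw [norm_smul, Complex.norm_natCast] at h1
  rw [le_div_iff₀ (pow_pos hlev 2)]
  calc ‖R k ν (tau (fine (lev L k) M) μ i) - R k ν i‖ * ((lev L k : ℕ) : ℝ) ^ 2
      = ((lev L k : ℕ) : ℝ) * ‖R k ν (tau (fine (lev L k) M) μ i) - R k ν i‖ * (lev L k : ℕ) := by ring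
    _ ≤ β / (lev L k : ℕ) * (lev L k : ℕ) := mul_le_mul_of_nonneg_right h1 hlev.le
    _ = β := div_mul_cancel₀ β hlev.ne'

/-- **THE CONVERSE CONSTRUCTOR**: per-bond size `α/L^k` and per-bond Lipschitz `β/(L^k)²` give `RegularTransporters L M R α β`. [folklore] -/
theorem regularTransporters_of_perBond (hα : 0 ≤ α) (hβ : 0 ≤ β) (hs : ∀ k ν (i : idx L M k), ‖R k ν i - 1‖ ≤ α / (lev L k : ℕ))
    (hl : ∀ k ν μ (i : idx L M k), ‖R k ν (tau (fine (lev L k) M) μ i) - R k ν i‖ ≤ β / (lev L k : ℕ) ^ 2) :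
    RegularTransporters L M R α β where
  nonneg := ⟨hα, hβ⟩
  size := fun k ν i => by
    have hlev := lev_pos L k
    rw [norm_smul, Complex.norm_natCast]
    calc ((lev L k : ℕ) : ℝ) * ‖R k ν i - 1‖ ≤ (lev L k : ℕ) * (α / (lev L k : ℕ)) := mul_le_mul_of_nonneg_left (hs k ν i) hlev.le
      _ = α := by field_simp
  lipschitz := fun k ν μ i => by
    have hlev := lev_pos L k
    rw [norm_smul, Complex.norm_natCast]
    calc ((lev L k : ℕ) : ℝ) * ‖R k ν (tau (fine (lev L k) M) μ i) - R k ν i‖ ≤ (lev L k : ℕ) * (β / (lev L k : ℕ) ^ 2) :=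
          mul_le_mul_of_nonneg_left (hl k ν μ i) hlev.le
      _ = β / (lev L k : ℕ) := by field_simp

end PerBond

/-! ## §2 The NE3 edge on a larger class of coefficient towers -/

section Class
variable (L : ℕ) [NeZero L] (M : Fin d → ℕ) [hM : ∀ μ, NeZero (M μ)]

omit [Fintype o] [DecidableEq o] [NeZero L] hM in
/-- `LocalRate` of the readings of a class is ANTITONE in the class. [folklore] -/
theorem localRate_bgReadings_mono {𝒟 𝒟' : Set ((k : ℕ) → Fin d → (idx L M k → Matrix o o ℂ))} (h𝒟 : 𝒟 ⊆ 𝒟') {C θ : ℝ}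
    (h : LocalRate (bgReadings L M 𝒟') C θ) : LocalRate (bgReadings L M 𝒟) C θ :=
  fun k W hW s => h k W (h𝒟 hW) s

variable {R : (k : ℕ) → Fin d → (idx L M k → Matrix o o ℂ)} {α β : ℝ}

/-- **THE TWO MATRIX-LEVEL HYPOTHESES FROM `hreg` AND ONE NE3 HYPOTHESIS ON ANY CLASS `𝒟 ⊇ regClass R`** (the assembly's shape: B7 feeds
node NE3 a single class containing every summand's coefficient towers). [folklore] -/
theorem matrixBounds_of_regular_of_localRate_sup (hreg : RegularTransporters L M R α β)
    {𝒟 : Set ((k : ℕ) → Fin d → (idx L M k → Matrix o o ℂ))} (h𝒟 : regClass L M R ⊆ 𝒟) {C : ℝ} (hC : 0 ≤ C)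
    (hNE3 : LocalRate (bgReadings L M 𝒟) C ((L : ℝ)⁻¹)) :
    LipschitzBackgroundM L M (fun k ν i => negConnM (fine (lev L k) M) ((lev L k : ℕ) : ℂ) (R k) ν i) α (max β (betaNE3 o C)) ∧
    BoundedBackgroundM L M (fun k i => zfieldC (fine (lev L k) M) ((lev L k : ℕ) : ℂ) (R k) i)
      (d * (α ^ 2 + 2 * β)) (d * (2 * α * (betaNE3 o C + β) + 2 * betaNE3 o C)) :=
  matrixBounds_of_regular_of_localRate L M hreg hC (localRate_bgReadings_mono L M h𝒟 hNE3)

variable (a : ℝ) (ha : 0 < a)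

/-- **THE COVARIANT-LAPLACIAN SUMMAND's `PerturbationLaws` FROM `hreg` AND NE3 ON ANY CLASS `𝒟 ⊇ regClass R`** (`d ≥ 1`; binders displayed;
constants as in `perturbationLaws_covariantLaplacian_of_regular`). [folklore] -/
theorem perturbationLaws_covariantLaplacian_of_regular_sup (hd : 1 ≤ d) (hreg : RegularTransporters L M R α β)
    {𝒟 : Set ((k : ℕ) → Fin d → (idx L M k → Matrix o o ℂ))} (h𝒟 : regClass L M R ⊆ 𝒟) {C : ℝ} (hC : 0 ≤ C)
    (hNE3 : LocalRate (bgReadings L M 𝒟) C ((L : ℝ)⁻¹)) :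
    PerturbationLaws (fun k => calDalev L M a ha k ⊗ₖ (1 : Matrix o o ℂ)) (covPertC L M R)
      (fun k => JpcT L M k ⊗ₖ (1 : Matrix o o ℂ)) (kappaCol o d a α (max β (betaNE3 o C)) (d * (α ^ 2 + 2 * β)))
      (fun k => C2col o d L a α (max β (betaNE3 o C)) (d * (2 * α * (betaNE3 o C + β) + 2 * betaNE3 o C)) * ((L : ℝ)⁻¹) ^ k) :=
  perturbationLaws_covariantLaplacian_of_regular L M a ha hd hreg hC (localRate_bgReadings_mono L M h𝒟 hNE3)

end Class

end Summit.QuantumFields.BalabanUV.T4Continuum.RegularTransportersPerBond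

end
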